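import Summits.Ventures.Crystal3D.Theorems.StickyWulffConstantGenericWallFloorConeCertificateRhoPerBall
import Summits.Ventures.Crystal3D.Theorems.StickyWulffConstantGenericWallFloorConeCertDataFcc6a
import Summits.Ventures.Crystal3D.Theorems.StickyWulffConstantGenericWallFloorConeCertDataFcc6b
import HarnessLib

/-!
# Per-ball tube radii `ρ_i` of the landed cone certificates — group `Fcc6` (lit g12 add-on)

Helper for `stmt-Ventures-19480` (E1 inside-tube half).  One `decide` per (certificate, free ball):
`cert_<frame>_<rep>_rhoAt_<i> : cert….rhoCheckAt i p 1000 = true`, `p = ⌊1000·ρ_i⌋` computed exactly from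
the LANDED multipliers (lit g12 `cert/perball.py`, pure rational arithmetic on the tree data files
`…ConeCertDataFcc6a,Fcc6b`).  With `ConeCert.eq_slots_rhoAt` / `eq_slotSet_of_slotMatched`
(`…ConeCertificateRhoPerBall`) the tube of a row is the PRODUCT of the per-ball caps — e.g. C12-55:
(0.074, 0.141, 0.141, 0.074, 0.141, 0.141, 0.201) instead of the uniform 0.074.

WHAT THIS IS NOT: no new certificate; the exhaustion outside the tube is eng's / cf-p2's.
-/

noncomputable section

namespace Summit.Ventures.Crystal3D.Theorems

/-- Per-ball tube radii of `cert_C12_938` (landed multipliers): ρ = (0.348, 0.201, 0.201, 0.201, 0.201, 0.348) for the free balls in slot order (uniform landed radius = the minimum, 0.201). -/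
theorem cert_C12_938_rhoAt_0 : cert_C12_938.rhoCheckAt 0 348 1000 = true := by decide
/-- Per-ball tube radius of `cert_C12_938`, free ball 1: `201/1000`. -/
theorem cert_C12_938_rhoAt_1 : cert_C12_938.rhoCheckAt 1 201 1000 = true := by decide
/-- Per-ball tube radius of `cert_C12_938`, free ball 2: `201/1000`. -/
theorem cert_C12_938_rhoAt_2 : cert_C12_938.rhoCheckAt 2 201 1000 = true := by decide
/-- Per-ball tube radius of `cert_C12_938`, free ball 3: `201/1000`. -/
theorem cert_C12_938_rhoAt_3 : cert_C12_938.rhoCheckAt 3 201 1000 = true := by decide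
/-- Per-ball tube radius of `cert_C12_938`, free ball 4: `201/1000`. -/
theorem cert_C12_938_rhoAt_4 : cert_C12_938.rhoCheckAt 4 201 1000 = true := by decide
/-- Per-ball tube radius of `cert_C12_938`, free ball 5: `348/1000`. -/
theorem cert_C12_938_rhoAt_5 : cert_C12_938.rhoCheckAt 5 348 1000 = true := by decide

end Summit.Ventures.Crystal3D.Theorems

end
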